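import Summits.NavierStokesRegularity.FunctionalMining.StretchingLaminateRecord5Asm
import Summits.NavierStokesRegularity.FunctionalMining.StretchingLaminateRecord4
import HarnessLib

/-!
# K1-Q1 laminates: hub-policy tree certificate — `0.68065 ≤ C_lam` and `0.68065 ≤ C⋆`, UNCONDITIONAL

Dict seat g20, staged 2026-08-21T16:50:53Z. NS FUNCTIONAL MINING cell (`pub-nsfunc`), dictionary
seat gen 20 — **search for candidate a priori estimates; no regularity claim.** STATIC field
inequalities only: nothing about Navier–Stokes solutions is asserted anywhere in this file.

THE TYPED RECORD of the laminate ladder, one step up: the kernel certificate of the bankʼs gen-13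
hub-policy tree `treeH14` (`StretchingLaminateRecord5A`–`C` data, `…P1`–`P4` kernel pieces, `…Asm`
assembly; source `pub-nsfunc-bank/tools/lam/runs/g13/hub14_full_cert.json` c71e719393ecaf9b;
mechanism, by value from the bank: a hub/excursion dynamic programme on the split lattice 1/K whose
optimal POLICY GRAPH is unfolded into a div-free lamination tree — the K = 14 policy reaches float
ratio 0.68065419; this file certifies the exact rational floor r = 13613/20000 = 0.68065): *
`treeH14_cert : treeH14.cert (13613/20000) = true` — assembled in `…Asm` from per-piece `decide
+kernel` evaluations (prove g14 measured that ONE `decide` cannot evaluate more than ≈ 4.3k node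
visits; this tree has 8677 splits); * `rH14_le_laminateSupConst : 13613/20000 ≤ C_lam`; *
`rH14_le_stretchingSupConst : 13613/20000 ≤ C⋆` UNCONDITIONALLY (via `laminateRealization_holds`),
with the window `stretchingSupConst_window_rH14 : 13613/20000 ≤ C⋆ ≤ 2/√3`. It supersedes the typed
record `3397/5000 = 0.6794` (`StretchingLaminateRecord4`, `r800_le_stretchingSupConst`) by `0.0013`
(`r800_lt_rH14`). HONEST SIZE. A certificate of ONE explicit laminate; the laminate METHOD is capped
in the kernel (`laminateSupConst_le_49_50` and the other caps) strictly below `2/√3`, and the paper-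
level cap of the method is `0.91` (bank THEOREM L-CAP-B, two-party exact certificate) — so this rung
says nothing about the VALUE of `C⋆` beyond the lower bound. search for candidate a priori
estimates; no regularity claim. [ours]
-/

namespace Summit.NavierStokesRegularity.FunctionalMining

namespace Laminate

/-- The new typed record beats the previous typed record `3397/5000` (`StretchingLaminateRecord4`).
[ours;
bookkeeping] -/
theorem r800_lt_rH14 : (3397 / 5000 : ℝ) < 13613 / 20000 := by norm_num

/-- **`13613/20000 = 0.68065 ≤ C_lam`** (the laminate constant). search for candidate a priori
estimates; no regularity claim. [ours] -/
theorem rH14_le_laminateSupConst : (13613 / 20000 : ℝ) ≤ laminateSupConst := by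
  have h := le_laminateSupConst_of_cert treeH14 (13613 / 20000) treeH14_cert
  push_cast at h
  exact h

/-- **`LaminateRealization → 0.68065 ≤ C⋆`.** search for candidate a priori estimates; no regularity
claim. [ours] -/
theorem laminate_rH14_le_stretchingSupConst (h : LaminateRealization) :
    (13613 / 20000 : ℝ) ≤ stretchingSupConst (d := Fin 3) :=
  le_trans rH14_le_laminateSupConst (laminateSupConst_le_stretchingSupConst h)

/-- **`0.68065 ≤ C⋆`, UNCONDITIONAL** (the laminate realization is the tree theorem
`laminateRealization_holds`).
search for candidate a priori estimates; no regularity claim. [ours] -/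
theorem rH14_le_stretchingSupConst : (13613 / 20000 : ℝ) ≤ stretchingSupConst (d := Fin 3) :=
  laminate_rH14_le_stretchingSupConst laminateRealization_holds

/-- **The kernel window after this record: `13613/20000 ≤ C⋆ ≤ 2/√3`.** search for candidate a
priori estimates; no regularity claim. [ours] -/
theorem stretchingSupConst_window_rH14 :
    (13613 / 20000 : ℝ) ≤ stretchingSupConst (d := Fin 3) ∧ stretchingSupConst (d := Fin 3) ≤ 2 / Real.sqrt 3 :=
  ⟨rH14_le_stretchingSupConst, stretchingSupConst_window_r800.2⟩

end Laminate

end Summit.NavierStokesRegularity.FunctionalMining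

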